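import Literature.IUT.HodgeTheaters.TemperedCoveringsCor23iiiProofs
import Literature.AnabelianGeometry.AbsoluteAnabelian.MLFSlimKummerProofs
import HarnessLib

/-!
# [IUTchI] Corollary 2.3 (iii): the `G_k` input "[AbsAnab], Theorem 1.1.1, (ii)" DISCHARGED (kurims p. 47)

Mochizuki, *Inter-universal Teichmüller theory I*, kurims manuscript (May 2020), §2, Cor. 2.3 (iii)
p. 47 [cite: Mochizuki2012, Cor 2.3(iii) p.47] (D-0012 claim key; series status DISPUTED — nothing
printed is asserted).  PROOF-ONLY sequel of `TemperedCoveringsCor23iiiProofs` (node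
IUTchI:Cor2.3(iii), abc-iut cell, D-0067 cone, layer L5, seat abc-iut-w4-d058).  No new definitions.

`StableCurveTemperedData.cor23iii_of_slim` derives the "in particular" of Cor. 2.3 (iii) — the exact
sequences `1 → Δ_{X,ℍ} → Π_{X,ℍ} → G_k → 1` of centre-free groups — from its printed inputs, one of
which is "[AbsAnab], Theorem 1.1.1, (ii)" (`G_k` is slim, hence centre-free), taken there as the
hypothesis `Subgroup.center D.Gk = ⊥` because the interface records `G_k` as a bare group.  That
theorem is PROVED in the tree for the absolute Galois group of an MLF
(`Literature.AnabelianGeometry.AbsoluteAnabelian.galoisMLF_slim_holds`, seat abc-iut-L4-d2).  Here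
the hypothesis is discharged for any data `D` whose `G_k` is identified with `Gal(k̄/k)` of an MLF
`k` (`center_Gk_eq_bot_of_mlf`), giving `cor23iii_of_slim_mlf` / `cor23iv_of_slim_mlf` with the
remaining inputs: the typed Cor. 2.3 (i), (ii), the slimness of `Δ̂_{X,ℍ}` BY NAME (print's deep first
sentence of (iii)), and the descent of the outer `G_k`-action to `Δ_{X,ℍ}` ((i) "in particular").
Nothing here bears on or takes a side on [IUTchIII] Cor. 3.12; typed ≠ discharged.
-/

noncomputable section

namespace Literature.IUT.HodgeTheaters

open Pointwise
open Literature.AlgebraicGeometry.Frobenioids (IsSlimGroup)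
open Literature.AnabelianGeometry.AbsoluteAnabelian (galoisMLF_slim galoisMLF_slim_holds)

universe u

/-- Centre-freeness transports along a group isomorphism. [cite: Mochizuki2012, Cor 2.3(iii) p.47] -/
theorem center_eq_bot_of_mulEquiv {A B : Type*} [Group A] [Group B] (e : A ≃* B)
    (hB : Subgroup.center B = ⊥) : Subgroup.center A = ⊥ := by
  rw [eq_bot_iff]
  intro z hz
  rw [Subgroup.mem_center_iff] at hz
  have h1 : e z ∈ Subgroup.center B := by
    rw [Subgroup.mem_center_iff]
    intro b
    obtain ⟨a, rfl⟩ := e.surjective b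
    rw [← map_mul, ← map_mul, hz a]
  rw [hB, Subgroup.mem_bot, ← map_one e] at h1
  rw [Subgroup.mem_bot]
  exact e.injective h1

/-- **[AbsAnab] Theorem 1.1.1 (ii), as quoted in Cor. 2.3 (iii)**: the absolute Galois group of an
MLF is centre-free — from the tree's PROVED `galoisMLF_slim_holds`. [cite: Mochizuki2012, Cor 2.3(iii) p.47] -/
theorem center_absoluteGaloisGroup_eq_bot (p : ℕ) [Fact p.Prime] (K : Type) [Field K]
    [Algebra ℚ_[p] K] [FiniteDimensional ℚ_[p] K] :
    Subgroup.center (Field.absoluteGaloisGroup K) = ⊥ :=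
  center_eq_bot_of_isSlimGroup (galoisMLF_slim_holds p K)

namespace StableCurveTemperedData

variable (D : StableCurveTemperedData.{u})

/-- **`Z(G_k) = 1`** for data whose `G_k` is [identified with] the absolute Galois group of an MLF `k`
("[AbsAnab], Theorem 1.1.1, (ii)", p. 47 — PROVED in the tree). [cite: Mochizuki2012, Cor 2.3(iii) p.47] -/
theorem center_Gk_eq_bot_of_mlf (p : ℕ) [Fact p.Prime] (K : Type) [Field K] [Algebra ℚ_[p] K]
    [FiniteDimensional ℚ_[p] K] (e : D.Gk ≃* Field.absoluteGaloisGroup K) :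
    Subgroup.center D.Gk = ⊥ :=
  center_eq_bot_of_mulEquiv e (center_absoluteGaloisGroup_eq_bot p K)

/-- **Corollary 2.3 (iii), the "in particular", with the `G_k` input discharged**: as
`cor23iii_of_slim`, for data `D` whose `G_k` is the absolute Galois group of an MLF `k`
(`e : D.Gk ≃* Gal(k̄/k)`); the remaining inputs are the typed Cor. 2.3 (i) (`hi`), (ii) (`hii`), the
slimness of `Δ̂_{X,ℍ}` BY NAME (`hslim`, print's deep first sentence of (iii), = the typed field
`Cor23iii.slim`) and the descent of the outer `G_k`-action (`hOutTp`, `hOutHat`, Cor. 2.3 (i) "in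
particular"; cf. `outerTp_of_graphStable`). [cite: Mochizuki2012, Cor 2.3(iii) p.47] -/
theorem cor23iii_of_slim_mlf [T2Space D.PiHat] (p : ℕ) [Fact p.Prime] (K : Type) [Field K]
    [Algebra ℚ_[p] K] [FiniteDimensional ℚ_[p] K] (e : D.Gk ≃* Field.absoluteGaloisGroup K)
    (hi : D.Cor23i) (hii : D.Cor23ii) (hslim : D.Cor23Hyp → IsSlimGroup D.deltaHatH)
    (hOutTp : ∀ g : D.PiTp, ∃ d : D.DeltaTp, MulAut.conj g • (D.deltaTpH.map D.DeltaTp.subtype) =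
      MulAut.conj (d : D.PiTp) • (D.deltaTpH.map D.DeltaTp.subtype))
    (hOutHat : ∀ γ : D.PiHat, ∃ d : D.DeltaHat,
      MulAut.conj γ • (D.deltaHatH.map D.DeltaHat.subtype) =
        MulAut.conj (d : D.PiHat) • (D.deltaHatH.map D.DeltaHat.subtype)) :
    D.Cor23iii :=
  D.cor23iii_of_slim hi hii hslim (D.center_Gk_eq_bot_of_mlf p K e) hOutTp hOutHat

/-- **Corollary 2.3 (iv) with the `G_k` input discharged** (proof, p. 49: (iv) ⇐ (i) + the exact
sequences of (iii)). [cite: Mochizuki2012, Cor 2.3(iv) p.49] -/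
theorem cor23iv_of_slim_mlf [T2Space D.PiHat] (p : ℕ) [Fact p.Prime] (K : Type) [Field K]
    [Algebra ℚ_[p] K] [FiniteDimensional ℚ_[p] K] (e : D.Gk ≃* Field.absoluteGaloisGroup K)
    (hi : D.Cor23i) (hii : D.Cor23ii) (hslim : D.Cor23Hyp → IsSlimGroup D.deltaHatH)
    (hOutTp : ∀ g : D.PiTp, ∃ d : D.DeltaTp, MulAut.conj g • (D.deltaTpH.map D.DeltaTp.subtype) =
      MulAut.conj (d : D.PiTp) • (D.deltaTpH.map D.DeltaTp.subtype))
    (hOutHat : ∀ γ : D.PiHat, ∃ d : D.DeltaHat,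
      MulAut.conj γ • (D.deltaHatH.map D.DeltaHat.subtype) =
        MulAut.conj (d : D.PiHat) • (D.deltaHatH.map D.DeltaHat.subtype)) :
    D.Cor23iv :=
  D.cor23iv_of_cor23i hi (D.cor23iii_of_slim_mlf p K e hi hii hslim hOutTp hOutHat)

end StableCurveTemperedData

end Literature.IUT.HodgeTheaters

end
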